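import Mathlib
import Literature.MathematicalPhysics.QuantumFieldTheory.Balaban1983to89.B6Prop23Printed

/-!
# `Balaban1983to89.B6Prop23TwoLevel` — p. 235 *"or it intersects B^{j+1}(Λ_{j+1}) also"*: the Proposition 2.3
certificate of `…B6Prop23Assembled`∕`…B6Prop23Printed` WITHOUT the single-level-support hypothesis `hlev` —
the chain (2.83) for a cube □′ whose partition function h_{□′} is supported on TWO adjacent levels, at the price
L⁴ ↦ L⁸ in the off-diagonal constant κ₄ (B6 = T. Bałaban, *Propagators and renormalization transformations for
lattice gauge theories. II*, Commun. Math. Phys. **96**, 223–250 (1984) [Balaban1984PropagatorsII]).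

CITATION HEADER (lean-in-tree rule 2026-08-18).  Cell `pub-balaban`, unit `b2b-balaban-b06-g14` (paper sub-cell B06,
gen 14 — the owner lineage of `…B6`, `…B6Ineq268`, `…B6Ineq283`, `…B6Line4Member12`, `…B6Prop23Chain`,
`…B6Prop23Assembled`, `…B6Prop23Printed`, which this NEW LEAF imports and does not modify).  Source:
doi:10.1007/bf01240221, held `paper:balaban1984-cmp96-propagators-rt-ii`; journal page = PDF page + 222; the
quotations below were read from the page renders `b2b-balaban-ref1/pages/1984-cmp96-propagators-rt-II/1984-cmp96-
propagators-rt-II-p013-x2.png` (p. 235) and `…-p015-x2.png` (p. 237) AS IMAGES (re-read by gen 14 for this module).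
Cell rows GAPS C-b06g14-1, DIVERGENCE D-b06.33; journal claim PROP23-TWO-LEVEL; it lifts the SCOPE CAVEAT "single-level
supports only (`hlev`)" recorded in the headers of `…B6Prop23Assembled` (v1.1) and `…B6Prop23Printed` (v1.1) and in
GAPS C-b06g12-2∕-3.

THE PRINTED TEXT.  p. 235 [PDF 13], verbatim: *"we take a second cube □̃ containing □ in the middle and of the size 4M
and we take an inverse of the operator (Q′G′(□̃)²Q′*)↾_□ instead of (Q′G′²Q′*)↾_□. Let us define
C_□ = ((Q′G′(□̃)²Q′*)↾_□)⁻¹, C = Σ_{□∈𝒟} h_□C_□h_□. (2.70) At first let us find bounds on C_□. We assume that either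
□̃ ⊂ B^j(Λ_j), or it intersects B^{j+1}(Λ_{j+1}) also."*  p. 237 [PDF 15], verbatim (the example □ ≠ □′ of (2.82)):
*"A kernel of this operator can be estimated as follows |(□′ − 1)(y)h²_□(y) Σ_{y″∈supp h_{□′}} (L^{j′}η)^d(Q′G′²Q′*)(y, y″)
h_{□′}(y″)C_{□′}(y″, y′)h_{□′}(y′)| ≤ O(1)(L^jη)⁴ Σ_{y″∈supp h_{□′}} e^{−½δ₀d(y,y″)}c₁(L^{j′}η)^{−d−4}e^{−δ₁(L^{j′}η)^{−1}|y″−y′|}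
≤ O(1)(L^jη)⁴(L^{j′}η)^{−4}e^{−¼δ₀d(y, supp h_{□′}) − δ₁d(y,y′)}(L^{j′}η)^{−d}
= O(1)e^{−⅛δ₀M}L^{4(j−j′)}e^{−⅛δ₀RM max{|j−j′|−1,0}}e^{−δ₁d(y,y′)}(L^{j′}η)^{−d} ≤ O(1)e^{−⅛δ₀M}e^{−δ₁d(y,y′)}(L^{j′}η)^{−d},
(2.83) where we have used the fact that y ∉ □̃′, and all the properties of the distance d(·, ·)."*

THE POINT.  The printed «=» of (2.83) converts e^{−⅛δ₀d(y, supp h_{□′})} into e^{−⅛δ₀RM max{|j−j′|−1,0}} by (2.60)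
applied to y ∈ Λ_j and a NEAREST support point y₀ of h_{□′} — tacitly AT THE LEVEL j′ OF y′ ("y″ ∈ Λ_{j′}" for every
y″ ∈ supp h_{□′}).  The sibling `…B6Ineq283` types exactly that (`line2_le_line5`, hypothesis `hsc : j(y₀) = j(y′)`),
and `…B6Prop23Assembled.offPiece_abs_le` therefore carries the hypothesis `hlev` "supp h_□ lies on ONE level", which
the printed p. 235 does NOT have: a cube □′ *"connected with a L^jη-scale"* whose enlargement □̃′ *"intersects
B^{j+1}(Λ_{j+1}) also"* has supp h_{□′} on the two adjacent levels j′, j′ + 1 (the sibling's cube fact `hcube`: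
every site of □′ has scale j_{□′} or j_{□′} + 1, and supp h_{□′} ⊂ □′ by □′h_{□′} = h_{□′}).  THIS MODULE runs the chain
at the nearest support point y₀ with |j(y₀) − j(y′)| ≤ 1: (2.60) at (y, y₀) gives RM·max{|j − j(y₀)| − 1, 0} ≤ D, the
weight absorption `B6Ineq283.ratio4_mul_exp_le` at (y, y₀) gives L^{4(j−j(y₀))}e^{−⅛δ₀RM max{|j−j(y₀)|−1,0}} ≤ L⁴, and
the one-sided level slack j(y₀) ≤ j(y′) + 1 costs L^{4(j−j′)} ≤ L⁴·L^{4(j−j(y₀))} (`ratio4_le_L4_mul`) — so member 3 of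
(2.83) is ≤ L⁸·e^{−⅛δ₀Mg}e^{−δ₁d(y,y′)} = L⁴·(member 5) under the SAME threshold L⁴ ≤ e^{⅛δ₀RM}, uniformly in the number
of scales k and in M: *"all the properties of the distance d(·, ·)"* suffice for the two-level case as well, with the
O(1) of (2.83)∕(2.85) multiplied by L⁴ (an L-dependent, k- and M-independent constant, harmless for *"O(M⁻¹)"* and
*"for M large enough"*).

WHAT THIS MODULE PROVES (kernel-checked; no `sorry`, no axiom beyond Lean's three; every analytic input a hypothesis
of the siblings' printed shape, the siblings' theorems invoked BY NAME, nothing duplicated or modified):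
1. §1 `ratio_le_L2_mul`, `ratio4_le_L4_mul` — the level slack: j(y₀) ≤ j(y′) + 1 ⟹ L^{4(j−j′)} ≤ L⁴·L^{4(j−j(y₀))};
   `line3_le_line5_twoLevel` — member 3 ≤ L⁴·member 5 with D realised at a support point ONE LEVEL OFF y′ at most;
   `line2_le_line5_twoLevel` — the whole chain member 2 ≤ c·L⁴·member 5 (`B6Ineq283.line2_le_line3` unchanged).
2. §2 `line4Ker_abs_le_285_twoLevel` — member 1 ≤ (A_X A_C c L⁸ e^{−⅛δ₀Mg})·e^{−δ₁d(y,y′)}·P(y′), the sibling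
   `B6Line4Member12.line4Ker_abs_le_285` with `hsc` replaced by j(y₀) ≤ j(y′) + 1.
3. §3 `offPiece_abs_le_twoLevel` — the off-diagonal family of (2.82) for ALL □, □′, y, y′ WITHOUT `hlev` (the slack
   j(y₀) ≤ j(y′) + 1 is DERIVED from `hph` + `hcube`: y₀, y′ ∈ supp h_{□′} ⊂ □′), ε = κ₄ᵀᴸe^{−⅛δ₀m_gM} with
   κ₄ᵀᴸ = B_X(B_C L^{d+4})c_σL⁸ = L⁴κ₄ (`kappa4TL`, `kappa4TL_eq`); `mat_off_abs_le_twoLevel`; `mat_R_abs_le_twoLevel` —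
   (2.85) |mat R y y′| ≤ θᵀᴸe^{−δ₁d(y,y′)}, θᵀᴸ = n₀(κ₂/M + κ₃e^{−c₃M}) + n₀²κ₄ᵀᴸe^{−(⅛δ₀m_g)M} (`theta285TL`; the diagonal
   families from `B6Prop23Assembled.mat_diag_abs_le` unchanged); `theta285TL_le` — θᵀᴸ ≤ Kᵀᴸ/M (`K285TL`), the printed
   *"O(M⁻¹)"*; `K285_le_K285TL` — the two-level threshold M ≥ 2Kᵀᴸc implies the single-level one;
   `prop23_assembled_twoLevel` — PROPOSITION 2.3 exactly as `B6Prop23Assembled.prop23_assembled` (existence, uniqueness,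
   G = C + GR, the kernel bound (2.87) with the SAME O(1) = 2n₀B_C L^{d+4}c) MINUS the hypothesis `hlev`, under
   M ≥ 2Kᵀᴸc.
4. §4 `prop23Printed_of_assembled_twoLevel` — the edge to the verbatim named fact `B6.Prop23Printed` of `…B6`, i.e.
   `B6Prop23Printed.prop23Printed_of_assembled` minus `hlev` (threshold constant Kᵀᴸ).
5. §5 CONSISTENCY ON A GENUINELY TWO-LEVEL MODEL: `tlGeo` (two sites at the scales 0 and 1 in ONE cube, d ≡ 0,
   L = η = 1, R = 0, M = 4, unit∕Kronecker kernels) — `tlGeo_hlev_fails` (the dropped hypothesis is FALSE there, so the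
   single-level certificates do not apply to this data) and `prop23Printed_twoLevel` (every hypothesis of the new edge
   is discharged on it: the theorem applied there), so the two-level package is consistent and strictly wider.
WHAT IT DOES NOT PROVE: any INPUT of the siblings (majorants of Q′G′²Q′*, Q′G′(□̃)²Q′*, the change-of-domain factor,
(2.81), the cover constants s, n₀, m_g, (2.60)∕(2.61)∕(2.63) for the realised geometry) — unchanged located status;
supports of h_□ on THREE or more levels (excluded by the printed p. 235 and by `hcube`); optimality of L⁸ (for
j(y₀) = j(y′) the sibling's L⁴ stands).  Value = the kernel certificate of Prop. 2.3 now covers the printed two-level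
boundary cubes — fidelity to the printed statement, NOT summit progress.
-/

namespace Literature.MathematicalPhysics.QuantumFieldTheory.Balaban1983to89.B6Prop23TwoLevel

open Literature.MathematicalPhysics.QuantumFieldTheory.Balaban1983to89
open Finset B6RandomWalk B6Lemma21Repaired B6Expansion282 B6Ineq283 B6Prop23Chain B6Line4Member12
  B6Prop23Assembled B6Prop23Printed

/-! ## §1. The level slack and the two-level chain (2.83), members 2 ⇒ 5 -/

section TwoLevelChain

variable {g : B6.Geometry}

/-- THE LEVEL SLACK at the second power: if j(y₀) ≤ j(y′) + 1 then L^{2(j−j′)} ≤ L²·L^{2(j−j(y₀))} (L ≥ 1).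
[folklore] -/
theorem ratio_le_L2_mul (hL : 1 ≤ g.L) {y y' y₀ : g.Site} (hadj : g.scale y₀ ≤ g.scale y' + 1) :
    B6Ineq268.ratio g y' y ≤ g.L ^ 2 * B6Ineq268.ratio g y₀ y := by
  have hL0 : 0 < g.L := zero_lt_one.trans_le hL
  have h1 : g.L ^ (2 * g.scale y₀) ≤ g.L ^ 2 * g.L ^ (2 * g.scale y') := by
    rw [← pow_add]
    exact pow_le_pow_right₀ hL (by omega)
  have hq : 1 ≤ g.L ^ 2 * g.L ^ (2 * g.scale y') / g.L ^ (2 * g.scale y₀) := by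
    rw [one_le_div (pow_pos hL0 _)]
    exact h1
  unfold B6Ineq268.ratio
  rw [div_le_iff₀ (pow_pos hL0 _)]
  calc g.L ^ (2 * g.scale y) = g.L ^ (2 * g.scale y) * 1 := (mul_one _).symm
    _ ≤ g.L ^ (2 * g.scale y) * (g.L ^ 2 * g.L ^ (2 * g.scale y') / g.L ^ (2 * g.scale y₀)) :=
        mul_le_mul_of_nonneg_left hq (pow_nonneg hL0.le _)
    _ = g.L ^ 2 * (g.L ^ (2 * g.scale y) / g.L ^ (2 * g.scale y₀)) * g.L ^ (2 * g.scale y') := by ring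

/-- THE LEVEL SLACK at the fourth power (the weight of (2.83)): if j(y₀) ≤ j(y′) + 1 then
(L^jη)⁴(L^{j′}η)^{−4} ≤ L⁴·(L^jη)⁴(L^{j(y₀)}η)^{−4}. [folklore] -/
theorem ratio4_le_L4_mul (hL : 1 ≤ g.L) {y y' y₀ : g.Site} (hadj : g.scale y₀ ≤ g.scale y' + 1) :
    ratio4 g y y' ≤ g.L ^ 4 * ratio4 g y y₀ := by
  have hL0 : 0 < g.L := zero_lt_one.trans_le hL
  have h := ratio_le_L2_mul hL (y := y) hadj
  unfold ratio4
  calc B6Ineq268.ratio g y' y ^ 2 ≤ (g.L ^ 2 * B6Ineq268.ratio g y₀ y) ^ 2 := pow_le_pow_left₀ (B6Ineq268.ratio_nonneg hL0.le _ _) h 2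
    _ = g.L ^ 4 * B6Ineq268.ratio g y₀ y ^ 2 := by ring

/-- **(2.83) MEMBER 3 ≤ L⁴ · MEMBER 5 FOR A TWO-LEVEL SUPPORT.**  If D ≥ d(y, y₀) for a support point y₀ with
j(y₀) ≤ j(y′) + 1, the gap Mg ≤ D (*"y ∉ □̃′"*), (2.60) in metric form, L ≥ 1 and the threshold L⁴ ≤ e^{⅛δ₀RM}, then
(L^jη)⁴(L^{j′}η)^{−4}e^{−¼δ₀D}e^{−δ₁d(y,y′)} ≤ L⁴·(L⁴e^{−⅛δ₀Mg}e^{−δ₁d(y,y′)}): ¼δ₀D ≥ ⅛δ₀Mg + ⅛δ₀RM·max{|j−j(y₀)|−1,0},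
the absorption L^{4(j−j(y₀))}e^{−⅛δ₀RM max{|j−j(y₀)|−1,0}} ≤ L⁴ (`B6Ineq283.ratio4_mul_exp_le`) and the slack
`ratio4_le_L4_mul`. [cite: Balaban1984PropagatorsII, (2.83) p.237 + «or it intersects B^{j+1}(Λ_{j+1}) also» p.235] -/
theorem line3_le_line5_twoLevel (hsep : B6Ineq268.LevelSep g) (hL : 1 ≤ g.L) {δ₀ δ₁ D Mg : ℝ} (hδ₀ : 0 ≤ δ₀)
    (hRM : 0 ≤ g.R * g.M) (hthr : g.L ^ 4 ≤ Real.exp (1 / 8 * δ₀ * g.R * g.M)) {y y' y₀ : g.Site}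
    (hadj : g.scale y₀ ≤ g.scale y' + 1) (hy₀ : g.dist y y₀ ≤ D) (hgap : Mg ≤ D) :
    line283_3 g δ₀ δ₁ D y y' ≤ g.L ^ 4 * line283_5 g δ₀ δ₁ Mg y y' := by
  have hL0 : 0 < g.L := zero_lt_one.trans_le hL
  have hβ : 0 ≤ 1 / 8 * δ₀ * g.R * g.M := by
    have : 0 ≤ δ₀ * (g.R * g.M) := mul_nonneg hδ₀ hRM
    linarith
  have hlev : g.R * g.M * B6Ineq268.mx g y y₀ ≤ D := (hsep y y₀).trans hy₀
  have hkey : Real.exp (-(1 / 4 * δ₀ * D)) ≤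
      Real.exp (-(1 / 8 * δ₀ * Mg)) * Real.exp (-(1 / 8 * δ₀ * g.R * g.M * B6Ineq268.mx g y y₀)) := by
    rw [← Real.exp_add, Real.exp_le_exp]
    have h1 : δ₀ * Mg ≤ δ₀ * D := mul_le_mul_of_nonneg_left hgap hδ₀
    have h2 : δ₀ * (g.R * g.M * B6Ineq268.mx g y y₀) ≤ δ₀ * D := mul_le_mul_of_nonneg_left hlev hδ₀
    linarith
  have habs : ratio4 g y y₀ * Real.exp (-(1 / 8 * δ₀ * g.R * g.M * B6Ineq268.mx g y y₀)) ≤ g.L ^ 4 :=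
    ratio4_mul_exp_le hL hβ hthr y y₀
  have hA : ratio4 g y y' ≤ g.L ^ 4 * ratio4 g y y₀ := ratio4_le_L4_mul hL hadj
  have hr₀ : 0 ≤ ratio4 g y y₀ := ratio4_nonneg y y₀
  have hr : 0 ≤ ratio4 g y y' := ratio4_nonneg y y'
  unfold line283_3 line283_5
  calc ratio4 g y y' * Real.exp (-(1 / 4 * δ₀ * D)) * Real.exp (-(δ₁ * g.dist y y'))
      ≤ (g.L ^ 4 * ratio4 g y y₀) *
          (Real.exp (-(1 / 8 * δ₀ * Mg)) * Real.exp (-(1 / 8 * δ₀ * g.R * g.M * B6Ineq268.mx g y y₀))) *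
          Real.exp (-(δ₁ * g.dist y y')) :=
        mul_le_mul_of_nonneg_right (mul_le_mul hA hkey (Real.exp_pos _).le (by positivity)) (Real.exp_pos _).le
    _ = g.L ^ 4 * (ratio4 g y y₀ * Real.exp (-(1 / 8 * δ₀ * g.R * g.M * B6Ineq268.mx g y y₀))) *
          Real.exp (-(1 / 8 * δ₀ * Mg)) * Real.exp (-(δ₁ * g.dist y y')) := by ring
    _ ≤ g.L ^ 4 * g.L ^ 4 * Real.exp (-(1 / 8 * δ₀ * Mg)) * Real.exp (-(δ₁ * g.dist y y')) := by
        have h4 : 0 ≤ g.L ^ 4 := pow_nonneg hL0.le 4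
        gcongr
    _ = g.L ^ 4 * (g.L ^ 4 * Real.exp (-(1 / 8 * δ₀ * Mg)) * Real.exp (-(δ₁ * g.dist y y'))) := by ring

/-- **THE WHOLE TWO-LEVEL CHAIN, MEMBER 2 ≤ c·L⁴·MEMBER 5**, under (2.54), d ≥ 0, (2.60) in metric form, (2.61) at α = σ
with δ₁ + σδ₀ ≤ ¼δ₀ and generic constant c, the straight-contour comparison on supp h_{□′}, D = d(y, supp h_{□′}) realised
by a support point y₀ AT MOST ONE LEVEL above y′, the gap Mg ≤ D and L⁴ ≤ e^{⅛δ₀RM} (`B6Ineq283.line2_le_line3` +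
`line3_le_line5_twoLevel`). [cite: Balaban1984PropagatorsII, (2.83) p.237 + p.235] -/
theorem line2_le_line5_twoLevel (htri : Triangle254 g) (hd : ∀ a b : g.Site, 0 ≤ g.dist a b)
    (hsep : B6Ineq268.LevelSep g) (hL : 1 ≤ g.L) {δ₀ δ₁ σ c D Mg : ℝ} (hδ₀ : 0 ≤ δ₀) (hδ₁ : 0 ≤ δ₁)
    (hsplit : δ₁ + σ * δ₀ ≤ δ₀ / 4) (h261 : Ineq261With c g δ₀ σ) (hRM : 0 ≤ g.R * g.M)
    (hthr : g.L ^ 4 ≤ Real.exp (1 / 8 * δ₀ * g.R * g.M)) {S' : Finset g.Site} {ρ : g.Site → ℝ}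
    {y y' y₀ : g.Site} (hρ : ∀ y'' ∈ S', g.dist y'' y' ≤ ρ y'') (hD : ∀ y'' ∈ S', D ≤ g.dist y y'')
    (hadj : g.scale y₀ ≤ g.scale y' + 1) (hy₀ : g.dist y y₀ ≤ D) (hgap : Mg ≤ D) :
    line283_2 g δ₀ δ₁ S' ρ y y' ≤ c * (g.L ^ 4 * line283_5 g δ₀ δ₁ Mg y y') := by
  have hc : 0 ≤ c := c_nonneg_of_ineq261With h261 y
  refine (line2_le_line3 htri hd hδ₀ hδ₁ hsplit h261 hρ hD).trans (mul_le_mul_of_nonneg_left ?_ hc)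
  exact line3_le_line5_twoLevel hsep hL hδ₀ hRM hthr hadj hy₀ hgap

end TwoLevelChain

/-! ## §2. Member 1 of (2.83) in the (2.85) shape, two-level support -/

section Member1

variable {g : B6.Geometry}

/-- **THE (2.85) READING OF THE OFF-DIAGONAL FAMILY, TWO-LEVEL SUPPORT**: with the inputs of
`B6Line4Member12.line4Ker_abs_le_285` except that the support point y₀ realising D = d(y, supp h_{□′}) is only required to
satisfy j(y₀) ≤ j(y′) + 1 (instead of j(y₀) = j(y′)):
|line4Ker(y, y′)| ≤ (A_X A_C c L⁸ e^{−⅛δ₀Mg})·e^{−δ₁d(y,y′)}·P(y′).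
[cite: Balaban1984PropagatorsII, (2.83)–(2.85) pp.237–238 + p.235] -/
theorem line4Ker_abs_le_285_twoLevel (htri : Triangle254 g) (hd : ∀ a b : g.Site, 0 ≤ g.dist a b)
    (hsep : B6Ineq268.LevelSep g) (hL : 1 ≤ g.L) (hη : 0 < g.eta)
    {δ₀ δ₁ σ c D Mg AX AC : ℝ} (hδ₀ : 0 ≤ δ₀) (hδ₁ : 0 ≤ δ₁) (hsplit : δ₁ + σ * δ₀ ≤ δ₀ / 4)
    (h261 : Ineq261With c g δ₀ σ) (hRM : 0 ≤ g.R * g.M)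
    (hthr : g.L ^ 4 ≤ Real.exp (1 / 8 * δ₀ * g.R * g.M)) (hAX : 0 ≤ AX) (hAC : 0 ≤ AC)
    {P : g.Site → ℝ} (hP : ∀ z, 0 ≤ P z)
    {w p' h h' : g.Site → ℝ} {X C : g.Site → g.Site → ℝ} {S' : Finset g.Site} {ρ : g.Site → ℝ}
    {y y' y₀ : g.Site}
    (hX : ∀ y'', |w y'' * X y y''| ≤ AX * g.len y ^ 4 * Real.exp (-(1 / 2 * δ₀ * g.dist y y'')))
    (hC : ∀ y'' ∈ S', |C y'' y'| ≤ AC * P y' / g.len y' ^ 4 * Real.exp (-(δ₁ * ρ y'')))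
    (hC0 : ∀ y'', y'' ∉ S' → C y'' y' = 0)
    (hρ : ∀ y'' ∈ S', g.dist y'' y' ≤ ρ y'') (hD : ∀ y'' ∈ S', D ≤ g.dist y y'')
    (hadj : g.scale y₀ ≤ g.scale y' + 1) (hy₀ : g.dist y y₀ ≤ D) (hgap : Mg ≤ D)
    (hp1 : |p' y - 1| ≤ 1) (hh1 : |h y| ≤ 1) (hh'1 : ∀ y'', |h' y''| ≤ 1) :
    |line4Ker w p' h h' X C y y'| ≤
      (AX * AC * c * g.L ^ 8 * Real.exp (-(1 / 8 * δ₀ * Mg))) * Real.exp (-(δ₁ * g.dist y y')) * P y' := by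
  refine ((line4Ker_abs_le hL hη hX hC hC0 hp1 hh1 hh'1).trans
    (mul_le_mul_of_nonneg_left
      (line2_le_line5_twoLevel htri hd hsep hL hδ₀ hδ₁ hsplit h261 hRM hthr hρ hD hadj hy₀ hgap)
      (mul_nonneg hAX (mul_nonneg hAC (hP y'))))).trans (le_of_eq ?_)
  simp only [line283_5]
  ring

end Member1

/-! ## §3. The off-diagonal family, (2.85) and Proposition 2.3 without `hlev` -/

section Pieces

variable {g : B6.Geometry} {D : Type}

/-- **LINE 4 (THE FAMILY □ ≠ □′, (2.83)), weighted entry, TWO-LEVEL SUPPORTS.**  For all cubes □, □′ and all y, y′: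
|(L^{j′}η)^d · ((□′ − 1)h_□²Xh_{□′}C_{□′}h_{□′})(y, y′)| ≤ (B_X (B_C L^{d+4}) c_σ L⁸ e^{−⅛δ₀·m_g M})·e^{−δ₁d(y,y′)} — the
statement of `B6Prop23Assembled.offPiece_abs_le` WITHOUT its hypothesis `hlev` (and with L⁴ ↦ L⁸): the nearest support
point y₀ of h_{□′} and the column y′ ∈ supp h_{□′} both lie in □′ (□′h_{□′} = h_{□′}), hence j(y₀) ≤ j_{□′} + 1 ≤ j(y′) + 1
by the cube scale fact, and `line4Ker_abs_le_285_twoLevel` applies.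
[cite: Balaban1984PropagatorsII, (2.83) p.237 + «or it intersects B^{j+1}(Λ_{j+1}) also» p.235] -/
theorem offPiece_abs_le_twoLevel (htri : Triangle254 g) (hd : ∀ a b : g.Site, 0 ≤ g.dist a b)
    (hsep : B6Ineq268.LevelSep g) (hL : 1 ≤ g.L) (hη : 0 < g.eta) {δ₀ δ₁ σ cσ mg BX BC : ℝ} (hδ₀ : 0 < δ₀)
    (hδ₁ : 0 ≤ δ₁) (hsplit : δ₁ + σ * δ₀ ≤ δ₀ / 4) (h261σ : Ineq261With cσ g δ₀ σ) (hRM : 0 ≤ g.R * g.M)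
    (hthr : g.L ^ 4 ≤ Real.exp (1 / 8 * δ₀ * g.R * g.M)) (hBX : 0 ≤ BX) (hBC : 0 ≤ BC) (d : ℕ)
    {pf hf : D → g.Site → ℝ} {js : D → ℕ} {X : g.Site → g.Site → ℝ} {Ck : D → g.Site → g.Site → ℝ}
    (hpf01 : ∀ i y, pf i y = 0 ∨ pf i y = 1) (hph : ∀ i y, pf i y * hf i y = hf i y)
    (hh1 : ∀ i y, |hf i y| ≤ 1) (hcube : ∀ i y, pf i y ≠ 0 → js i ≤ g.scale y ∧ g.scale y ≤ js i + 1)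
    (hgap : ∀ i y y'', pf i y = 0 → hf i y'' ≠ 0 → mg * g.M ≤ g.dist y y'')
    (hX : ∀ y y'', |g.len y'' ^ d * X y y''| ≤ BX * g.len y ^ 4 * Real.exp (-(1 / 2 * δ₀ * g.dist y y'')))
    (h281 : ∀ i y y', pf i y ≠ 0 → pf i y' ≠ 0 →
      |Ck i y y'| ≤ BC / (g.L ^ js i * g.eta) ^ (d + 4) * Real.exp (-(δ₁ * g.dist y y')))
    (i i' : D) (y y' : g.Site) :
    |g.len y' ^ d * line4Ker (fun z => g.len z ^ d) (pf i') (hf i) (hf i') X (Ck i') y y'| ≤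
      (BX * (BC * g.L ^ (d + 4)) * cσ * g.L ^ 8 * Real.exp (-(1 / 8 * δ₀ * (mg * g.M)))) *
        Real.exp (-(δ₁ * g.dist y y')) := by
  classical
  have hL0 : 0 < g.L := zero_lt_one.trans_le hL
  have hlen : ∀ z : g.Site, 0 < g.len z := fun z => mul_pos (pow_pos hL0 _) hη
  have hc0 : 0 ≤ cσ := c_nonneg_of_ineq261With h261σ y
  have hRHS : 0 ≤ (BX * (BC * g.L ^ (d + 4)) * cσ * g.L ^ 8 * Real.exp (-(1 / 8 * δ₀ * (mg * g.M)))) *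
      Real.exp (-(δ₁ * g.dist y y')) := by positivity
  set w : g.Site → ℝ := fun z => g.len z ^ d with hw
  by_cases hy' : hf i' y' = 0
  · have : line4Ker w (pf i') (hf i) (hf i') X (Ck i') y y' = 0 := by unfold line4Ker; rw [hy', mul_zero]
    rw [this, mul_zero, abs_zero]; exact hRHS
  by_cases hy : pf i' y = 0
  swap
  · -- y ∈ □′: the factor (□′(y) − 1) vanishes
    have h1 : pf i' y = 1 := (hpf01 i' y).resolve_left hy
    have : line4Ker w (pf i') (hf i) (hf i') X (Ck i') y y' = 0 := by
      unfold line4Ker; rw [h1, sub_self, zero_mul, zero_mul, zero_mul]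
    rw [this, mul_zero, abs_zero]; exact hRHS
  -- y ∉ □′, y′ ∈ supp h_{□′} ⊂ □′
  have hpy' : pf i' y' ≠ 0 := pf_ne_zero_of_hf_ne_zero hph hy'
  set C' : g.Site → g.Site → ℝ := fun y'' z => if hf i' y'' = 0 then 0 else Ck i' y'' z with hC'
  set S' : Finset g.Site := Finset.univ.filter fun y'' => hf i' y'' ≠ 0 with hS'
  have hne : S'.Nonempty := ⟨y', Finset.mem_filter.mpr ⟨Finset.mem_univ _, hy'⟩⟩
  obtain ⟨y₀, hy₀S, hy₀min⟩ := Finset.exists_min_image S' (fun y'' => g.dist y y'') hne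
  have hy₀ : hf i' y₀ ≠ 0 := (Finset.mem_filter.mp hy₀S).2
  -- the two-level slack: y₀ and y′ lie in □′, whose sites have scale j_{□′} or j_{□′} + 1
  have hadj : g.scale y₀ ≤ g.scale y' + 1 := scale_le_of_cube hcube (pf_ne_zero_of_hf_ne_zero hph hy₀) hpy'
  set Dm : ℝ := g.dist y y₀ with hDm
  have hCb : ∀ y'' ∈ S', |C' y'' y'| ≤ BC * g.L ^ (d + 4) * (g.len y' ^ d)⁻¹ / g.len y' ^ 4 *
      Real.exp (-(δ₁ * g.dist y'' y')) := by
    intro y'' hy''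
    have h'' : hf i' y'' ≠ 0 := (Finset.mem_filter.mp hy'').2
    rw [hC']; simp only [if_neg h'']
    exact ck_weighted_le d hL hη hBC hcube h281 (pf_ne_zero_of_hf_ne_zero hph h'') hpy'
  have hC0 : ∀ y'', y'' ∉ S' → C' y'' y' = 0 := by
    intro y'' hy''
    have : ¬ hf i' y'' ≠ 0 := fun h => hy'' (Finset.mem_filter.mpr ⟨Finset.mem_univ _, h⟩)
    rw [hC']; simp only [not_not.mp this, if_true]
  have hmain := line4Ker_abs_le_285_twoLevel htri hd hsep hL hη hδ₀.le hδ₁ hsplit h261σ hRM hthr hBX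
    (by positivity : 0 ≤ BC * g.L ^ (d + 4)) (P := fun z => (g.len z ^ d)⁻¹)
    (fun z => inv_nonneg.mpr (pow_nonneg (hlen z).le d)) (w := w) (p' := pf i') (h := hf i) (h' := hf i')
    (X := X) (C := C') (S' := S') (ρ := fun y'' => g.dist y'' y') (y := y) (y' := y') (y₀ := y₀) (D := Dm)
    (Mg := mg * g.M) (hX y) hCb hC0 (fun y'' _ => le_rfl) (fun y'' hy'' => hy₀min y'' hy'')
    hadj le_rfl (hgap i' y y₀ hy hy₀) (abs_pf_sub_one_le_one hpf01 i' y) (hh1 i y) (hh1 i')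
  have hwP : g.len y' ^ d * (g.len y' ^ d)⁻¹ = 1 := mul_inv_cancel₀ (pow_pos (hlen y') d).ne'
  rw [line4Ker_mask, abs_mul, abs_of_pos (pow_pos (hlen y') d)]
  calc g.len y' ^ d * |line4Ker w (pf i') (hf i) (hf i') X C' y y'|
      ≤ g.len y' ^ d * ((BX * (BC * g.L ^ (d + 4)) * cσ * g.L ^ 8 * Real.exp (-(1 / 8 * δ₀ * (mg * g.M)))) *
          Real.exp (-(δ₁ * g.dist y y')) * (g.len y' ^ d)⁻¹) :=
        mul_le_mul_of_nonneg_left hmain (pow_nonneg (hlen y').le d)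
    _ = (BX * (BC * g.L ^ (d + 4)) * cσ * g.L ^ 8 * Real.exp (-(1 / 8 * δ₀ * (mg * g.M)))) *
          Real.exp (-(δ₁ * g.dist y y')) * (g.len y' ^ d * (g.len y' ^ d)⁻¹) := by ring
    _ = _ := by rw [hwP, mul_one]

/-- κ₄ᵀᴸ: the size of the off-diagonal family in front of e^{−⅛δ₀m_gM} for two-level supports, B_X(B_C L^{d+4})c_σL⁸
(`offPiece_abs_le_twoLevel`). [cite: Balaban1984PropagatorsII, (2.83)/(2.85) pp.237–238] -/
noncomputable def kappa4TL (g : B6.Geometry) (d : ℕ) (cσ BX BC : ℝ) : ℝ :=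
  BX * (BC * g.L ^ (d + 4)) * cσ * g.L ^ 8

/-- Bookkeeping: κ₄ᵀᴸ = L⁴·κ₄ (`B6Prop23Assembled.kappa4`). [folklore] -/
theorem kappa4TL_eq (g : B6.Geometry) (d : ℕ) (cσ BX BC : ℝ) :
    kappa4TL g d cσ BX BC = g.L ^ 4 * kappa4 g d cσ BX BC := by
  unfold kappa4TL kappa4
  ring

/-- θᵀᴸ of (2.85) for two-level supports: θᵀᴸ = n₀(κ₂/M + κ₃e^{−c₃M}) + n₀²κ₄ᵀᴸe^{−(⅛δ₀m_g)M} — the printed *"O(M⁻¹)"*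
with every constant explicit (the diagonal sizes κ₂, κ₃ of `…B6Prop23Assembled` unchanged).
[cite: Balaban1984PropagatorsII, (2.85) p.238] -/
noncomputable def theta285TL (g : B6.Geometry) (d n₀ : ℕ) (s δ₀ cσ c₃ mg BX BD BC : ℝ) : ℝ :=
  n₀ * (kappa2 g d s δ₀ cσ BX BC / g.M + kappa3 g d cσ BD BC * Real.exp (-(c₃ * g.M))) +
    n₀ ^ 2 * (kappa4TL g d cσ BX BC * Real.exp (-((1 / 8 * δ₀ * mg) * g.M)))

/-- Kᵀᴸ with θᵀᴸ ≤ Kᵀᴸ/M (`B6Prop23Chain.theta_le_inv_M`): Kᵀᴸ = n₀(κ₂ + κ₃/(e c₃)) + n₀²κ₄ᵀᴸ/(e·⅛δ₀m_g).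
[cite: Balaban1984PropagatorsII, (2.85) p.238] -/
noncomputable def K285TL (g : B6.Geometry) (d n₀ : ℕ) (s δ₀ cσ c₃ mg BX BD BC : ℝ) : ℝ :=
  n₀ * (kappa2 g d s δ₀ cσ BX BC + kappa3 g d cσ BD BC / (Real.exp 1 * c₃)) +
    n₀ ^ 2 * (kappa4TL g d cσ BX BC / (Real.exp 1 * (1 / 8 * δ₀ * mg)))

/-- **θᵀᴸ = O(M⁻¹)**: θᵀᴸ ≤ Kᵀᴸ/M (Kᵀᴸ M-independent when n₀, s, m_g, the B's and c_σ are).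
[cite: Balaban1984PropagatorsII, (2.85) «O(M⁻¹)» p.238] -/
theorem theta285TL_le (hM : 0 < g.M) {d n₀ : ℕ} {s δ₀ cσ c₃ mg BX BD BC : ℝ} (hδ₀ : 0 < δ₀) (hc₃ : 0 < c₃)
    (hmg : 0 < mg) (hcσ : 0 ≤ cσ) (hBX : 0 ≤ BX) (hBD : 0 ≤ BD) (hBC : 0 ≤ BC) (hL : 0 ≤ g.L) :
    theta285TL g d n₀ s δ₀ cσ c₃ mg BX BD BC ≤ K285TL g d n₀ s δ₀ cσ c₃ mg BX BD BC / g.M := by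
  unfold theta285TL K285TL
  exact theta_le_inv_M hM hc₃ (by positivity : 0 < 1 / 8 * δ₀ * mg) (by unfold kappa3; positivity)
    (by unfold kappa4TL; positivity) (Nat.cast_nonneg n₀)

/-- The two-level constant dominates the single-level one: K ≤ Kᵀᴸ (L ≥ 1, non-negative sizes), so the threshold
*"M large enough"* in the form M ≥ 2Kᵀᴸc implies the single-level threshold M ≥ 2Kc of `…B6Prop23Assembled`.
[folklore] -/
theorem K285_le_K285TL (hL : 1 ≤ g.L) {d n₀ : ℕ} {s δ₀ cσ c₃ mg BX BD BC : ℝ} (hδ₀ : 0 < δ₀) (hmg : 0 < mg)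
    (hcσ : 0 ≤ cσ) (hBX : 0 ≤ BX) (hBC : 0 ≤ BC) :
    K285 g d n₀ s δ₀ cσ c₃ mg BX BD BC ≤ K285TL g d n₀ s δ₀ cσ c₃ mg BX BD BC := by
  have hL0 : 0 ≤ g.L := zero_le_one.trans hL
  have h48 : g.L ^ 4 ≤ g.L ^ 8 := pow_le_pow_right₀ hL (by norm_num)
  have hκ : kappa4 g d cσ BX BC ≤ kappa4TL g d cσ BX BC := by
    unfold kappa4 kappa4TL
    exact mul_le_mul_of_nonneg_left h48 (by positivity)
  have he : 0 < Real.exp 1 * (1 / 8 * δ₀ * mg) := by positivity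
  unfold K285 K285TL
  gcongr

variable [DecidableEq g.Site] [Fintype D] [DecidableEq D]

omit [Fintype D] in
/-- **THE OFF-DIAGONAL TERMS R_{□,□′}C_{□′}h_{□′}, □ ≠ □′, TWO-LEVEL SUPPORTS** — `B6Prop23Assembled.mat_off_abs_le`
without `hlev`: |mat(R_{□,□′}C_{□′}h_{□′}) y y′| ≤ κ₄ᵀᴸe^{−(⅛δ₀m_g)M}·e^{−δ₁d(y,y′)}.
[cite: Balaban1984PropagatorsII, (2.83)/(2.85) pp.237–238 + p.235] -/
theorem mat_off_abs_le_twoLevel (htri : Triangle254 g) (hd : ∀ a b : g.Site, 0 ≤ g.dist a b)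
    (hsep : B6Ineq268.LevelSep g) (hL : 1 ≤ g.L) (hη : 0 < g.eta) {δ₀ δ₁ σ cσ mg BX BC : ℝ} (hδ₀ : 0 < δ₀)
    (hδ₁ : 0 ≤ δ₁) (hsplit : δ₁ + σ * δ₀ ≤ δ₀ / 4) (h261σ : Ineq261With cσ g δ₀ σ) (hRM : 0 ≤ g.R * g.M)
    (hthr : g.L ^ 4 ≤ Real.exp (1 / 8 * δ₀ * g.R * g.M)) (hBX : 0 ≤ BX) (hBC : 0 ≤ BC) (d : ℕ)
    {pf hf : D → g.Site → ℝ} {js : D → ℕ} {X : g.Site → g.Site → ℝ} {Xw Ck : D → g.Site → g.Site → ℝ}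
    (hpf01 : ∀ i y, pf i y = 0 ∨ pf i y = 1) (hph : ∀ i y, pf i y * hf i y = hf i y)
    (hh1 : ∀ i y, |hf i y| ≤ 1) (hcube : ∀ i y, pf i y ≠ 0 → js i ≤ g.scale y ∧ g.scale y ≤ js i + 1)
    (hgap : ∀ i y y'', pf i y = 0 → hf i y'' ≠ 0 → mg * g.M ≤ g.dist y y'')
    (hX : ∀ y y'', |g.len y'' ^ d * X y y''| ≤ BX * g.len y ^ 4 * Real.exp (-(1 / 2 * δ₀ * g.dist y y'')))
    (h281 : ∀ i y y', pf i y ≠ 0 → pf i y' ≠ 0 →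
      |Ck i y y'| ≤ BC / (g.L ^ js i * g.eta) ^ (d + 4) * Real.exp (-(δ₁ * g.dist y y')))
    {i i' : D} (hii : i ≠ i') (y y' : g.Site) :
    |mat (Rpair (kerOp (fun z => g.len z ^ d) X) (fun i => mulOp (pf i))
        (fun i => kerOp (fun z => g.len z ^ d) (Xw i)) (fun i => mulOp (hf i)) i i' *
        kerOp (fun z => g.len z ^ d) (Ck i') * mulOp (hf i')) y y'| ≤
      kappa4TL g d cσ BX BC * Real.exp (-((1 / 8 * δ₀ * mg) * g.M)) * Real.exp (-(δ₁ * g.dist y y')) := by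
  set w : g.Site → ℝ := fun z => g.len z ^ d with hw
  have hop : Rpair (kerOp w X) (fun i => mulOp (pf i)) (fun i => kerOp w (Xw i)) (fun i => mulOp (hf i)) i i' *
        kerOp w (Ck i') * mulOp (hf i') = kerOp w (line4Ker w (pf i') (hf i) (hf i') X (Ck i')) := by
    rw [Rpair_ne _ _ _ _ hii, line4_operator_eq]
  rw [hop, mat_kerOp]
  have h4 := offPiece_abs_le_twoLevel htri hd hsep hL hη hδ₀ hδ₁ hsplit h261σ hRM hthr hBX hBC d hpf01 hph hh1
    hcube hgap hX h281 i i' y y'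
  refine h4.trans (le_of_eq ?_)
  simp only [kappa4TL]
  ring_nf

/-- **(2.85) WITH NO PER-TERM HYPOTHESIS AND NO SINGLE-LEVEL HYPOTHESIS LEFT**: |mat R y y′| ≤ θᵀᴸ·e^{−δ₁d(y,y′)}
(`B6Prop23Assembled.mat_diag_abs_le` for the diagonal families, `mat_off_abs_le_twoLevel` for □ ≠ □′, and the counting
assembly `B6Prop23Chain.mat_R282_abs_le` with the overlap number n₀). [cite: Balaban1984PropagatorsII, (2.85) p.238] -/
theorem mat_R_abs_le_twoLevel (htri : Triangle254 g) (hd : ∀ a b : g.Site, 0 ≤ g.dist a b)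
    (hsep : B6Ineq268.LevelSep g) (hL : 1 ≤ g.L) (hη : 0 < g.eta) (hM : 0 < g.M) (hRM : 0 ≤ g.R * g.M)
    {δ₀ δ₁ σ cσ c₃ s mg BX BD BC : ℝ} (hδ₀ : 0 < δ₀) (hδ₁ : 0 ≤ δ₁) (hsplit : δ₁ + σ * δ₀ ≤ δ₀ / 4)
    (h261σ : Ineq261With cσ g δ₀ σ) (hthr : g.L ^ 4 ≤ Real.exp (1 / 8 * δ₀ * g.R * g.M)) (hs : 0 ≤ s)
    (hBX : 0 ≤ BX) (hBD : 0 ≤ BD) (hBC : 0 ≤ BC) (d : ℕ)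
    {pf hf : D → g.Site → ℝ} {js : D → ℕ} {n₀ : ℕ} {X : g.Site → g.Site → ℝ}
    {Xw Ck : D → g.Site → g.Site → ℝ}
    (hover : ∀ y, (Finset.univ.filter fun i => hf i y ≠ 0).card ≤ n₀)
    (hpf01 : ∀ i y, pf i y = 0 ∨ pf i y = 1) (hph : ∀ i y, pf i y * hf i y = hf i y)
    (hh1 : ∀ i y, |hf i y| ≤ 1) (hLip : ∀ i y y'', |hf i y - hf i y''| ≤ s / g.M * g.dist y y'')
    (hcube : ∀ i y, pf i y ≠ 0 → js i ≤ g.scale y ∧ g.scale y ≤ js i + 1)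
    (hgap : ∀ i y y'', pf i y = 0 → hf i y'' ≠ 0 → mg * g.M ≤ g.dist y y'')
    (hX : ∀ y y'', |g.len y'' ^ d * X y y''| ≤ BX * g.len y ^ 4 * Real.exp (-(1 / 2 * δ₀ * g.dist y y'')))
    (hXw : ∀ i y y'', |g.len y'' ^ d * Xw i y y''| ≤ BX * g.len y ^ 4 * Real.exp (-(1 / 2 * δ₀ * g.dist y y'')))
    (hdom : ∀ i y y'', |pf i y * (g.len y'' ^ d * (Xw i y y'' - X y y'')) * hf i y''| ≤
      BD * Real.exp (-(c₃ * g.M)) * g.len y ^ 4 * Real.exp (-(1 / 2 * δ₀ * g.dist y y'')))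
    (h281 : ∀ i y y', pf i y ≠ 0 → pf i y' ≠ 0 →
      |Ck i y y'| ≤ BC / (g.L ^ js i * g.eta) ^ (d + 4) * Real.exp (-(δ₁ * g.dist y y')))
    (hCk0 : ∀ i y'' y', pf i y'' = 0 → Ck i y'' y' = 0) (y y' : g.Site) :
    |mat (R282 (kerOp (fun z => g.len z ^ d) X) (fun i => mulOp (pf i))
        (fun i => kerOp (fun z => g.len z ^ d) (Xw i)) (fun i => mulOp (hf i))
        (fun i => kerOp (fun z => g.len z ^ d) (Ck i))) y y'| ≤
      theta285TL g d n₀ s δ₀ cσ c₃ mg BX BD BC * Real.exp (-(δ₁ * g.dist y y')) := by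
  have hc0 : 0 ≤ cσ := c_nonneg_of_ineq261With h261σ y
  have hL0 : 0 < g.L := zero_lt_one.trans_le hL
  have hεd : 0 ≤ kappa2 g d s δ₀ cσ BX BC / g.M + kappa3 g d cσ BD BC * Real.exp (-(c₃ * g.M)) := by
    unfold kappa2 kappa3; positivity
  have hεo : 0 ≤ kappa4TL g d cσ BX BC * Real.exp (-((1 / 8 * δ₀ * mg) * g.M)) := by
    unfold kappa4TL; positivity
  have h := mat_R282_abs_le (kerOp (fun z => g.len z ^ d) X) (fun i => kerOp (fun z => g.len z ^ d) (Xw i))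
    (fun i => kerOp (fun z => g.len z ^ d) (Ck i)) pf hf hover (E := fun y y' => Real.exp (-(δ₁ * g.dist y y')))
    (fun _ _ => (Real.exp_pos _).le) hεd hεo
    (fun i y y' => mat_diag_abs_le htri hd hL hη hδ₀ hδ₁ hsplit h261σ hs hM hBX hBD hBC d hpf01 hph hh1 hLip
      hcube hXw hdom h281 hCk0 i y y')
    (fun i i' hii y y' => mat_off_abs_le_twoLevel htri hd hsep hL hη hδ₀ hδ₁ hsplit h261σ hRM hthr hBX hBC d
      hpf01 hph hh1 hcube hgap hX h281 hii y y') y y'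
  refine h.trans (le_of_eq ?_)
  simp only [theta285TL]

/-- **PROPOSITION 2.3 ASSEMBLED, TWO-LEVEL SUPPORTS** — the statement of `B6Prop23Assembled.prop23_assembled` (same
carrier, same located inputs, same conclusion: existence and uniqueness of the two-sided inverse G of X = Q′G′²Q′* on
L²(𝔅), G = C + GR ((2.86)), and *"|(Q′G′²Q′*)⁻¹(y, y′)| ≤ O(1)(L^jη)^{−4}(L^{j′}η)^{−d}e^{−½δ₁d(y,y′)}"* (2.87) with
O(1) = 2n₀B_C L^{d+4}c) WITHOUT the hypothesis `hlev` "supp h_□ on one level": the supports may meet the two adjacent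
levels j_□, j_□ + 1 of their cube, as the printed p. 235 allows (*"either □̃ ⊂ B^j(Λ_j), or it intersects B^{j+1}(Λ_{j+1})
also"*).  The threshold *"for M large enough"* is M ≥ 2Kᵀᴸc (`K285TL`, ≥ the single-level K).
[cite: Balaban1984PropagatorsII, Prop. 2.3, (2.82)–(2.87) pp.237–238 + p.235] -/
theorem prop23_assembled_twoLevel (d : ℕ) (htri : Triangle254 g) (hrefl : ∀ y : g.Site, g.dist y y = 0)
    (hd : ∀ a b : g.Site, 0 ≤ g.dist a b) (hsep : B6Ineq268.LevelSep g) (hL : 1 ≤ g.L) (hη : 0 < g.eta)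
    (hM : 0 < g.M) (hRM : 0 ≤ g.R * g.M)
    {δ₀ δ₁ σ cσ c c₃ s mg BX BD BC : ℝ} (hδ₀ : 0 < δ₀) (hδ₁ : 0 ≤ δ₁) (hsplit : δ₁ + σ * δ₀ ≤ δ₀ / 4)
    (h261σ : Ineq261With cσ g δ₀ σ) (hthr : g.L ^ 4 ≤ Real.exp (1 / 8 * δ₀ * g.R * g.M))
    (h261 : Ineq261With c g δ₁ (1 / 2)) (h263 : Ineq263With c g δ₁ (1 / 2)) (hc : 0 ≤ c)
    (hc₃ : 0 < c₃) (hs : 0 ≤ s) (hmg : 0 < mg) (hBX : 0 ≤ BX) (hBD : 0 ≤ BD) (hBC : 0 ≤ BC)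
    {pf hf : D → g.Site → ℝ} {js : D → ℕ} {n₀ : ℕ} {X : g.Site → g.Site → ℝ}
    {Xw Ck : D → g.Site → g.Site → ℝ}
    (hover : ∀ y, (Finset.univ.filter fun i => hf i y ≠ 0).card ≤ n₀)
    (hpf01 : ∀ i y, pf i y = 0 ∨ pf i y = 1) (hph : ∀ i y, pf i y * hf i y = hf i y)
    (h236 : ∀ y, ∑ i, hf i y ^ 2 = 1) (hLip : ∀ i y y'', |hf i y - hf i y''| ≤ s / g.M * g.dist y y'')
    (hcube : ∀ i y, pf i y ≠ 0 → js i ≤ g.scale y ∧ g.scale y ≤ js i + 1)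
    (hgap : ∀ i y y'', pf i y = 0 → hf i y'' ≠ 0 → mg * g.M ≤ g.dist y y'')
    (hX : ∀ y y'', |g.len y'' ^ d * X y y''| ≤ BX * g.len y ^ 4 * Real.exp (-(1 / 2 * δ₀ * g.dist y y'')))
    (hXw : ∀ i y y'', |g.len y'' ^ d * Xw i y y''| ≤ BX * g.len y ^ 4 * Real.exp (-(1 / 2 * δ₀ * g.dist y y'')))
    (hdom : ∀ i y y'', |pf i y * (g.len y'' ^ d * (Xw i y y'' - X y y'')) * hf i y''| ≤
      BD * Real.exp (-(c₃ * g.M)) * g.len y ^ 4 * Real.exp (-(1 / 2 * δ₀ * g.dist y y'')))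
    (h281 : ∀ i y y', pf i y ≠ 0 → pf i y' ≠ 0 →
      |Ck i y y'| ≤ BC / (g.L ^ js i * g.eta) ^ (d + 4) * Real.exp (-(δ₁ * g.dist y y')))
    (hCk0 : ∀ i y'' y', pf i y'' = 0 → Ck i y'' y' = 0)
    (h270 : ∀ i, locOp (fun i => mulOp (pf i)) (fun i => kerOp (fun z => g.len z ^ d) (Xw i)) i *
      kerOp (fun z => g.len z ^ d) (Ck i) * mulOp (hf i) = mulOp (hf i))
    (hKM : 2 * K285TL g d n₀ s δ₀ cσ c₃ mg BX BD BC * c ≤ g.M) :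
    ∃ G : Module.End ℝ (g.Site → ℝ),
      G * kerOp (fun z => g.len z ^ d) X = 1 ∧ kerOp (fun z => g.len z ^ d) X * G = 1 ∧
      G = Cglued (fun i => mulOp (hf i)) (fun i => kerOp (fun z => g.len z ^ d) (Ck i)) +
        G * R282 (kerOp (fun z => g.len z ^ d) X) (fun i => mulOp (pf i))
          (fun i => kerOp (fun z => g.len z ^ d) (Xw i)) (fun i => mulOp (hf i))
          (fun i => kerOp (fun z => g.len z ^ d) (Ck i)) ∧
      (∀ G' : Module.End ℝ (g.Site → ℝ), G' * kerOp (fun z => g.len z ^ d) X = 1 → G' = G) ∧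
      ∀ y y', |mat G y y' / g.len y' ^ d| ≤
        2 * (n₀ * (BC * g.L ^ (d + 4))) * c * g.len y ^ (-(4 : ℝ)) * g.len y' ^ (-(d : ℝ)) *
          Real.exp (-(δ₁ / 2 * g.dist y y')) := by
  -- an empty carrier 𝔅 makes every operator on ℝ^𝔅 equal: nothing to prove
  rcases isEmpty_or_nonempty g.Site with he | hne
  · exact ⟨0, Subsingleton.elim _ _, Subsingleton.elim _ _, Subsingleton.elim _ _, fun G' _ => Subsingleton.elim _ _,
      fun y _ => (he.false y).elim⟩
  obtain ⟨y₀⟩ := hne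
  have hcσ : 0 ≤ cσ := c_nonneg_of_ineq261With h261σ y₀
  have hL0 : 0 < g.L := zero_lt_one.trans_le hL
  have hlen : ∀ z : g.Site, 0 < g.len z := fun z => mul_pos (pow_pos hL0 _) hη
  have hh1 : ∀ i y, |hf i y| ≤ 1 := abs_hf_le_one h236
  -- (2.82): X·C = 1 − R
  have hphOp : ∀ i, mulOp (pf i) * mulOp (hf i) = mulOp (hf i) := by
    intro i
    rw [mulOp_mul_mulOp]
    exact congrArg mulOp (funext fun y => hph i y)
  have hXC := expansion282 (kerOp (fun z => g.len z ^ d) X) (p := fun i => mulOp (pf i))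
    (t := fun i => kerOp (fun z => g.len z ^ d) (Xw i)) (h := fun i => mulOp (hf i))
    (c := fun i => kerOp (fun z => g.len z ^ d) (Ck i)) hphOp (partitionSq_mulOp hf h236) h270
  -- (2.85) with θᵀᴸ explicit, θᵀᴸ ≤ Kᵀᴸ/M, and «M large enough»
  set θ : ℝ := theta285TL g d n₀ s δ₀ cσ c₃ mg BX BD BC with hθdef
  have hθ0 : 0 ≤ θ := by
    rw [hθdef]; unfold theta285TL kappa2 kappa3 kappa4TL; positivity
  have hR : ∀ y y', |mat (R282 (kerOp (fun z => g.len z ^ d) X) (fun i => mulOp (pf i))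
      (fun i => kerOp (fun z => g.len z ^ d) (Xw i)) (fun i => mulOp (hf i))
      (fun i => kerOp (fun z => g.len z ^ d) (Ck i))) y y'| ≤ θ * Real.exp (-(δ₁ * g.dist y y')) :=
    fun y y' => mat_R_abs_le_twoLevel htri hd hsep hL hη hM hRM hδ₀ hδ₁ hsplit h261σ hthr hs hBX hBD hBC d hover
      hpf01 hph hh1 hLip hcube hgap hX hXw hdom h281 hCk0 y y'
  have hθK : θ ≤ K285TL g d n₀ s δ₀ cσ c₃ mg BX BD BC / g.M :=
    theta285TL_le hM hδ₀ hc₃ hmg hcσ hBX hBD hBC hL0.le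
  obtain ⟨-, hsmall, hinv2⟩ := smallness_of_M_large hM hc hθK hKM
  -- the C-majorant from the glued (2.81)
  have hscH : ∀ i y, hf i y ≠ 0 → g.scale y ≤ js i + 1 :=
    fun i y h => (hcube i y (pf_ne_zero_of_hf_ne_zero hph h)).2
  have h281H : ∀ i y y', hf i y ≠ 0 → hf i y' ≠ 0 →
      |Ck i y y'| ≤ BC / (g.L ^ js i * g.eta) ^ (d + 4) * Real.exp (-(δ₁ * g.dist y y')) :=
    fun i y y' hy hy' => h281 i y y' (pf_ne_zero_of_hf_ne_zero hph hy) (pf_ne_zero_of_hf_ne_zero hph hy')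
  have hC := mat_Cglued_abs_le d hL hη hf Ck js hover hh1 hscH hBC h281H
  set A : ℝ := n₀ * (BC * g.L ^ (d + 4)) with hAdef
  have hA : 0 ≤ A := by positivity
  obtain ⟨G, hGX, hXG, hfix, huniq, hb⟩ := prop23_kernel_287 d hL0 hη c δ₁ θ A hA hθ0 hc hδ₁ htri hrefl hd
    h261 h263 hsmall hXC (fun y y' => hC y y') hR
  refine ⟨G, hGX, hXG, hfix, huniq, fun y y' => (hb y y').trans ?_⟩
  have hP : 0 ≤ g.len y ^ (-(4 : ℝ)) * g.len y' ^ (-(d : ℝ)) * Real.exp (-(δ₁ / 2 * g.dist y y')) := by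
    have := (hlen y).le; have := (hlen y').le; positivity
  calc A * c * (1 - θ * c)⁻¹ * g.len y ^ (-(4 : ℝ)) * g.len y' ^ (-(d : ℝ)) * Real.exp (-(δ₁ / 2 * g.dist y y'))
      = (1 - θ * c)⁻¹ * (A * c) *
          (g.len y ^ (-(4 : ℝ)) * g.len y' ^ (-(d : ℝ)) * Real.exp (-(δ₁ / 2 * g.dist y y'))) := by ring
    _ ≤ 2 * (A * c) * (g.len y ^ (-(4 : ℝ)) * g.len y' ^ (-(d : ℝ)) * Real.exp (-(δ₁ / 2 * g.dist y y'))) :=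
        mul_le_mul_of_nonneg_right (mul_le_mul_of_nonneg_right hinv2 (mul_nonneg hA hc)) hP
    _ = 2 * A * c * g.len y ^ (-(4 : ℝ)) * g.len y' ^ (-(d : ℝ)) * Real.exp (-(δ₁ / 2 * g.dist y y')) := by
        ring

end Pieces

/-! ## §4. The edge to the verbatim named fact `B6.Prop23Printed`, two-level supports -/

section Edge

/-- **THE EDGE `prop23_assembled_twoLevel` ⟹ `B6.Prop23Printed`** — the statement of
`B6Prop23Printed.prop23Printed_of_assembled` (a family of situations `geo : I → B6.Geometry` with cube data and kernels,
UNIFORM constants, a common threshold M₁ ≥ 2Kᵀᴸ_i c, a common O(1) C ≥ 2n₀B_C L_i^{d+4}c, and the dictionary "`Cinv i` is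
the (2.69)-kernel of an inverse of X_i whenever M₁ ≤ M_i") WITHOUT the single-level hypothesis `hlev`; conclusion the
printed Proposition 2.3 in the verbatim typing of `…B6`, witnesses (M₁, δ₁, C).
[cite: Balaban1984PropagatorsII, Prop. 2.3 (2.86)–(2.87) p.238 + p.235] -/
theorem prop23Printed_of_assembled_twoLevel {I : Type} (d : ℕ) (geo : I → B6.Geometry)
    [∀ i, DecidableEq (geo i).Site] (Cinv : ∀ i, B6.SiteKernel (geo i))
    (htri : ∀ i, Triangle254 (geo i)) (hrefl : ∀ i (y : (geo i).Site), (geo i).dist y y = 0)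
    (hd : ∀ i (a b : (geo i).Site), 0 ≤ (geo i).dist a b) (hsep : ∀ i, B6Ineq268.LevelSep (geo i))
    (hL : ∀ i, 1 ≤ (geo i).L) (hη : ∀ i, 0 < (geo i).eta) (hM : ∀ i, 0 < (geo i).M)
    (hRM : ∀ i, 0 ≤ (geo i).R * (geo i).M)
    {δ₀ δ₁ σ cσ c c₃ s mg BX BD BC M₁ C : ℝ} {n₀ : ℕ}
    (hδ₀ : 0 < δ₀) (hδ₁ : 0 < δ₁) (hsplit : δ₁ + σ * δ₀ ≤ δ₀ / 4)
    (h261σ : ∀ i, Ineq261With cσ (geo i) δ₀ σ)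
    (hthr : ∀ i, M₁ ≤ (geo i).M → (geo i).L ^ 4 ≤ Real.exp (1 / 8 * δ₀ * (geo i).R * (geo i).M))
    (h261 : ∀ i, Ineq261With c (geo i) δ₁ (1 / 2)) (h263 : ∀ i, Ineq263With c (geo i) δ₁ (1 / 2)) (hc : 0 ≤ c)
    (hc₃ : 0 < c₃) (hs : 0 ≤ s) (hmg : 0 < mg) (hBX : 0 ≤ BX) (hBD : 0 ≤ BD) (hBC : 0 ≤ BC)
    (hM₁ : 0 < M₁) (hC : 0 < C)
    (hKM : ∀ i, 2 * K285TL (geo i) d n₀ s δ₀ cσ c₃ mg BX BD BC * c ≤ M₁)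
    (hCB : ∀ i, 2 * (n₀ * (BC * (geo i).L ^ (d + 4))) * c ≤ C)
    {D : I → Type} [∀ i, Fintype (D i)] [∀ i, DecidableEq (D i)]
    {pf hf : ∀ i, D i → (geo i).Site → ℝ} {js : ∀ i, D i → ℕ} {X : ∀ i, (geo i).Site → (geo i).Site → ℝ}
    {Xw Ck : ∀ i, D i → (geo i).Site → (geo i).Site → ℝ}
    (hover : ∀ i y, (Finset.univ.filter fun a => hf i a y ≠ 0).card ≤ n₀)
    (hpf01 : ∀ i a y, pf i a y = 0 ∨ pf i a y = 1) (hph : ∀ i a y, pf i a y * hf i a y = hf i a y)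
    (h236 : ∀ i y, ∑ a, hf i a y ^ 2 = 1)
    (hLip : ∀ i a y y'', |hf i a y - hf i a y''| ≤ s / (geo i).M * (geo i).dist y y'')
    (hcube : ∀ i a y, pf i a y ≠ 0 → js i a ≤ (geo i).scale y ∧ (geo i).scale y ≤ js i a + 1)
    (hgap : ∀ i a y y'', pf i a y = 0 → hf i a y'' ≠ 0 → mg * (geo i).M ≤ (geo i).dist y y'')
    (hX : ∀ i y y'', |(geo i).len y'' ^ d * X i y y''| ≤
      BX * (geo i).len y ^ 4 * Real.exp (-(1 / 2 * δ₀ * (geo i).dist y y'')))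
    (hXw : ∀ i a y y'', |(geo i).len y'' ^ d * Xw i a y y''| ≤
      BX * (geo i).len y ^ 4 * Real.exp (-(1 / 2 * δ₀ * (geo i).dist y y'')))
    (hdom : ∀ i a y y'', |pf i a y * ((geo i).len y'' ^ d * (Xw i a y y'' - X i y y'')) * hf i a y''| ≤
      BD * Real.exp (-(c₃ * (geo i).M)) * (geo i).len y ^ 4 * Real.exp (-(1 / 2 * δ₀ * (geo i).dist y y'')))
    (h281 : ∀ i a y y', pf i a y ≠ 0 → pf i a y' ≠ 0 →
      |Ck i a y y'| ≤ BC / ((geo i).L ^ js i a * (geo i).eta) ^ (d + 4) * Real.exp (-(δ₁ * (geo i).dist y y')))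
    (hCk0 : ∀ i a y'' y', pf i a y'' = 0 → Ck i a y'' y' = 0)
    (h270 : ∀ i a, locOp (fun a => mulOp (pf i a)) (fun a => kerOp (fun z => (geo i).len z ^ d) (Xw i a)) a *
      kerOp (fun z => (geo i).len z ^ d) (Ck i a) * mulOp (hf i a) = mulOp (hf i a))
    (hinv : ∀ i, M₁ ≤ (geo i).M → ∃ G : Module.End ℝ ((geo i).Site → ℝ),
      G * kerOp (fun z => (geo i).len z ^ d) (X i) = 1 ∧
        ∀ y y', (Cinv i).ker y y' = mat G y y' / (geo i).len y' ^ d) :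
    B6.Prop23Printed d geo Cinv := by
  refine ⟨M₁, δ₁, C, hM₁, hδ₁, hC, fun i _ hMi y y' => ?_⟩
  obtain ⟨G, -, -, -, huniq, hb⟩ := prop23_assembled_twoLevel (g := geo i) d (htri i) (hrefl i) (hd i) (hsep i)
    (hL i) (hη i) (hM i) (hRM i) hδ₀ hδ₁.le hsplit (h261σ i) (hthr i hMi) (h261 i) (h263 i) hc hc₃ hs hmg hBX hBD
    hBC (hover i) (hpf01 i) (hph i) (h236 i) (hLip i) (hcube i) (hgap i) (hX i) (hXw i) (hdom i) (h281 i)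
    (hCk0 i) (h270 i) ((hKM i).trans hMi)
  obtain ⟨G', hG'X, hker⟩ := hinv i hMi
  rw [hker y y', huniq G' hG'X]
  refine (hb y y').trans ?_
  have hL0 : 0 < (geo i).L := zero_lt_one.trans_le (hL i)
  have hlen : ∀ z : (geo i).Site, 0 < (geo i).len z := fun z => mul_pos (pow_pos hL0 _) (hη i)
  exact mul_le_mul_of_nonneg_right (mul_le_mul_of_nonneg_right (mul_le_mul_of_nonneg_right (hCB i)
    (Real.rpow_nonneg (hlen y).le _)) (Real.rpow_nonneg (hlen y').le _)) (Real.exp_pos _).le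

end Edge

/-! ## §5. Consistency on a genuinely two-level model: two sites at the scales 0 and 1 in one cube -/

section TwoLevelModel

/-- The two-site carrier 𝔅 = {ff, tt} with j(ff) = 0, j(tt) = 1 (ONE cube meeting TWO levels), d ≡ 0, η = L = 1,
R = 0, M = 4 — a consistency model only: every hypothesis of `prop23Printed_of_assembled_twoLevel` holds on it with
□ = h_□ = 1 and X = X̃_□ = C_□ = the Kronecker kernel, while the dropped hypothesis `hlev` FAILS (`tlGeo_hlev_fails`).
[folklore] -/
@[reducible] noncomputable def tlGeo : B6.Geometry where
  Site := Bool
  fin := inferInstance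
  scale := fun b => if b then 1 else 0
  dist := fun _ _ => 0
  k := 1
  eta := 1
  L := 1
  R := 0
  M := 4
  Hyp21_22 := True
  Loc := PUnit
  suppIn := fun _ _ => True
  supNorm := fun _ => 0
  l2Norm := fun _ => 0
  holder := fun _ _ => 0
  Cut := PUnit
  cutIn := fun _ _ => True
  cutH := fun _ _ => 0
  cutSup := fun _ => 0

/-- Unfolding: d ≡ 0 on the two-level model. [folklore] -/
@[simp] theorem tlGeo_dist (a b : tlGeo.Site) : tlGeo.dist a b = 0 := rfl

/-- Unfolding: the scale of the site tt is 1. [folklore] -/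
@[simp] theorem tlGeo_scale_true : tlGeo.scale true = 1 := rfl

/-- Unfolding: the scale of the site ff is 0. [folklore] -/
@[simp] theorem tlGeo_scale_false : tlGeo.scale false = 0 := rfl

/-- Unfolding: L = 1 on the two-level model. [folklore] -/
@[simp] theorem tlGeo_L : tlGeo.L = 1 := rfl

/-- Unfolding: M = 4 on the two-level model. [folklore] -/
@[simp] theorem tlGeo_M : tlGeo.M = 4 := rfl

/-- Unfolding: R = 0 on the two-level model. [folklore] -/
@[simp] theorem tlGeo_R : tlGeo.R = 0 := rfl

/-- Unfolding: η = 1 on the two-level model. [folklore] -/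
@[simp] theorem tlGeo_eta : tlGeo.eta = 1 := rfl

/-- L^jη = 1 on the two-level model (L = η = 1 at both scales). [folklore] -/
@[simp] theorem tlGeo_len (a : tlGeo.Site) : tlGeo.len a = 1 := by simp [B6.Geometry.len]

/-- Every site of the model has scale ≤ 1 (the cube scale fact with j_□ = 0). [folklore] -/
theorem tlGeo_scale_le_one (a : tlGeo.Site) : tlGeo.scale a ≤ 1 := by
  cases a <;> simp

/-- On the two-site carrier every chain of unit kernels with m + 1 factors is 2^m. [folklore] -/
theorem tlGeo_chain_one (m : ℕ) (y y' : tlGeo.Site) :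
    B6RandomWalk.chain (fun _ _ : tlGeo.Site => (1 : ℝ)) m y y' = 2 ^ m := by
  induction m generalizing y with
  | zero => simp
  | succ m ih =>
      rw [B6RandomWalk.chain_succ]
      simp only [ih, one_mul]
      rw [show (Finset.univ : Finset tlGeo.Site) = {true, false} from rfl]
      simp [pow_succ]
      ring

/-- … in particular the (2.63) chains at any rate r (d ≡ 0). [folklore] -/
theorem tlGeo_chain_rate (r : ℝ) (m : ℕ) (y y' : tlGeo.Site) :
    B6RandomWalk.chain (fun a b : tlGeo.Site => Real.exp (-(r * tlGeo.dist a b))) m y y' = 2 ^ m := by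
  have hk : (fun a b : tlGeo.Site => Real.exp (-(r * tlGeo.dist a b))) = fun _ _ => 1 := by
    funext a b; simp
  rw [hk, tlGeo_chain_one]

/-- (2.61) with the generic constant 2 holds on the model at every rate (two sites, d ≡ 0). [folklore] -/
theorem tlGeo_ineq261 (δ α : ℝ) : Ineq261With 2 tlGeo δ α := by
  intro y
  rw [show (Finset.univ : Finset tlGeo.Site) = {true, false} from rfl]
  simp

/-- (2.63) with the generic constant 2 holds on the model at every rate: 2^m ≤ 2^{m+1}. [folklore] -/
theorem tlGeo_ineq263 (δ α : ℝ) : Ineq263With 2 tlGeo δ α := by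
  intro m y y'
  rw [tlGeo_chain_rate]
  simp only [mul_zero, neg_zero, Real.exp_zero, mul_one]
  exact pow_le_pow_right₀ one_le_two (Nat.le_succ m)

/-- The Kronecker kernel with unit weights is the identity operator. [folklore] -/
theorem kerOp_one_delta {S : Type} [Fintype S] [DecidableEq S] :
    kerOp (fun _ : S => (1 : ℝ)) (fun y y'' => if y = y'' then (1 : ℝ) else 0) = 1 := by
  refine LinearMap.ext fun μ => funext fun y => ?_
  simp only [kerOp_apply, Module.End.one_apply, one_mul, ite_mul, zero_mul, Finset.sum_ite_eq, Finset.mem_univ,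
    if_true]

/-- Multiplication by the constant function 1 is the identity operator. [folklore] -/
theorem mulOp_const_one {S : Type} [Fintype S] : mulOp (fun _ : S => (1 : ℝ)) = 1 := by
  refine LinearMap.ext fun μ => funext fun y => ?_
  simp only [mulOp_apply, Module.End.one_apply, one_mul]

/-- The matrix entry of the identity is the Kronecker kernel. [folklore] -/
theorem mat_one {S : Type} [DecidableEq S] (y y' : S) :
    mat (1 : Module.End ℝ (S → ℝ)) y y' = if y = y' then 1 else 0 := by
  simp only [mat, Module.End.one_apply, Pi.single_apply]

/-- The constant Kᵀᴸ of θᵀᴸ ≤ Kᵀᴸ/M on the two-level model is 2/e (n₀ = 1, s = 0, δ₀ = 8, c_σ = 2, c₃ = m_g = B_X = B_C = 1,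
B_D = 0). [folklore] -/
theorem tlGeo_K285TL (d : ℕ) : K285TL tlGeo d 1 0 8 2 1 1 1 0 1 = 2 / Real.exp 1 := by
  unfold K285TL kappa2 kappa3 kappa4TL
  norm_num

/-- «M large enough» on the two-level model: 2Kᵀᴸ·c = 8/e ≤ 4 = M (c = 2). [folklore] -/
theorem tlGeo_threshold (d : ℕ) : 2 * K285TL tlGeo d 1 0 8 2 1 1 1 0 1 * 2 ≤ 4 := by
  have h2e : (2 : ℝ) ≤ Real.exp 1 := by
    have := Real.add_one_le_exp (1 : ℝ); norm_num at this ⊢; linarith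
  have he : 0 < Real.exp 1 := Real.exp_pos 1
  rw [tlGeo_K285TL]
  rw [show 2 * (2 / Real.exp 1) * 2 = 8 / Real.exp 1 by ring, div_le_iff₀ he]
  linarith

/-- **THE DROPPED HYPOTHESIS FAILS ON THE MODEL**: with h_□ ≡ 1 on the one cube, supp h_□ = {ff, tt} meets the two
levels 0 ≠ 1, so `hlev` of `B6Prop23Assembled.prop23_assembled`∕`B6Prop23Printed.prop23Printed_of_assembled` is false for
this data — the single-level certificates cannot be instantiated here, the two-level ones below are. [folklore] -/
theorem tlGeo_hlev_fails :
    ¬ (∀ (a : Unit) (y y' : tlGeo.Site), (fun (_ : Unit) (_ : tlGeo.Site) => (1 : ℝ)) a y ≠ 0 →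
        (fun (_ : Unit) (_ : tlGeo.Site) => (1 : ℝ)) a y' ≠ 0 → tlGeo.scale y = tlGeo.scale y') := by
  intro h
  have h01 := h () false true one_ne_zero one_ne_zero
  simp at h01

/-- **NON-VACUITY OF THE TWO-LEVEL EDGE ON A TWO-LEVEL MODEL**: on the one-situation family over `tlGeo` (one cube,
□ = h_□ = 1, Kronecker kernels X = X̃_□ = C_□, cube scale j_□ = 0 with sites at the scales 0 AND 1, δ₀ = 8, δ₁ = 1,
σ = s = B_D = 0, c_σ = c = 2, c₃ = m_g = B_X = B_C = 1, n₀ = 1, M₁ = 4, C = 4, Cinv = the Kronecker kernel = the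
(2.69)-kernel of the inverse 1 of X = 1) every hypothesis of `prop23Printed_of_assembled_twoLevel` is discharged — the
term below is the theorem applied there — so the printed named fact holds on that family by this route and the
two-level hypothesis package is consistent on data violating `hlev`. [folklore] -/
theorem prop23Printed_twoLevel (d : ℕ) :
    B6.Prop23Printed d (fun _ : Unit => tlGeo) (fun _ => ⟨fun y y' => if y = y' then (1 : ℝ) else 0⟩) :=
  prop23Printed_of_assembled_twoLevel (geo := fun _ : Unit => tlGeo) d _ (δ₀ := 8) (δ₁ := 1) (σ := 0) (cσ := 2)
    (c := 2) (c₃ := 1) (s := 0) (mg := 1) (BX := 1) (BD := 0) (BC := 1) (M₁ := 4) (C := 4) (n₀ := 1)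
    (D := fun _ => Unit) (pf := fun _ _ _ => 1) (hf := fun _ _ _ => 1) (js := fun _ _ => 0)
    (X := fun _ y y'' => if y = y'' then 1 else 0) (Xw := fun _ _ y y'' => if y = y'' then 1 else 0)
    (Ck := fun _ _ y y'' => if y = y'' then 1 else 0)
    (fun _ _ _ _ => by simp) (fun _ _ => rfl) (fun _ _ _ => le_rfl)
    (fun _ y y' => by show (0 : ℝ) * 4 * B6Ineq268.mx tlGeo y y' ≤ 0; simp) (fun _ => le_rfl) (fun _ => one_pos)
    (fun _ => by show (0 : ℝ) < 4; norm_num) (fun _ => by show (0 : ℝ) ≤ 0 * 4; norm_num) (by norm_num) one_pos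
    (by norm_num) (fun _ => tlGeo_ineq261 8 0) (fun _ _ => by simp) (fun _ => tlGeo_ineq261 1 (1 / 2))
    (fun _ => tlGeo_ineq263 1 (1 / 2)) zero_le_two one_pos le_rfl one_pos zero_le_one le_rfl zero_le_one
    (by norm_num) (by norm_num) (fun _ => tlGeo_threshold d) (fun _ => by norm_num)
    (fun _ _ => (Finset.card_filter_le _ _).trans (by simp)) (fun _ _ _ => Or.inr rfl) (fun _ _ _ => one_mul _)
    (fun _ _ => by simp) (fun _ _ _ _ => by simp) (fun _ _ y _ => ⟨Nat.zero_le _, tlGeo_scale_le_one y⟩)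
    (fun _ _ _ _ h _ => absurd h one_ne_zero)
    (fun _ y y'' => by by_cases h : y = y'' <;> simp [h])
    (fun _ _ y y'' => by by_cases h : y = y'' <;> simp [h])
    (fun _ _ _ _ => by simp) (fun _ _ y y' _ _ => by by_cases h : y = y' <;> simp [h])
    (fun _ _ _ _ h => absurd h one_ne_zero)
    (fun _ _ => by
      simp only [tlGeo_len, one_pow, locOp, kerOp_one_delta, mulOp_const_one, mul_one])
    (fun _ _ => ⟨1, by simp only [tlGeo_len, one_pow, kerOp_one_delta, mul_one], fun y y' => by
      rw [mat_one]; simp⟩)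

end TwoLevelModel

end Literature.MathematicalPhysics.QuantumFieldTheory.Balaban1983to89.B6Prop23TwoLevel
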